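import Mathlib
import HarnessLib
import HarnessLib.Audit
import Summits.NavierStokesRegularity.Statement
import Literature.Analysis.FluidPDE.ClassicalSolution
import Literature.Analysis.FluidPDE.LerayHopf
import Literature.Analysis.FluidPDE.SuitableWeak
import Literature.Analysis.FluidPDE.SelfSimilar
import Literature.Analysis.FluidPDE.LocalTypeI
import Literature.Analysis.FluidPDE.AxisymmetricEuler
import Literature.Analysis.FluidPDE.NSWave0
import Summits.NavierStokesRegularity.NavierStokesRegularity.Theorems.TypeICertificateLadderNoBlowupToClay

/-!
Route: RellichScar

DORMANT since 2026-09-04T10:53:48Z (reconciler: no traction for 5 d (last activity statement-claimed at 2026-08-30T10:20:50Z); parked, not closed — `ledger route dormant route-NavierStokesRegularity-RellichScar --off` to reactivate) — unstaffed, not closed; items shared with open routes are served there. `ledger route dormant <id> --off` reactivates.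

# Route RellichScar — the blow-up-time scar is a complete invariant of a Type-I tangent flow

X = NoApexTypeIProfile ("it suffices to show"): no suitable weak solution (u,p) of Navier–Stokes (ν
= 1, f = 0) on the slab
ℝ³×(−∞,0) with Albritton–Barker quantity 𝐈(ℝ³×ℝ₋) < ∞ and the SPACE–TIME Type-I bound |u(x,t)| ≤
C/(|x|+√−t) (KNSS2009 (1.6),
tree `HasTypeIDecay`) is singular at the space–time origin — "Type-I apex profiles do not exist".
The route realises card
scar-rigidity-rellich-final-slice: X is reached as ScarRigidity ∧ SymmetricScarExists (+ known
Liouville kills), where the SCAR of an apex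
profile is its trace u(·,0) on ℝ³∖{0} (rendered without a new definition: two profiles have the same
scar iff ess sup of |u₁−u₂| over
(−δ,0)×K tends to 0 as δ↓0 for every compact K ∌ 0). ScarRigidity (card K1): two apex profiles
singular at the origin with the same scar
coincide. SymmetricScarExists (card Z): if singular apex profiles exist, one of them has a
(−1)-homogeneous or an axisymmetric scar. X decides
Clay (A) through ApexLocalisation (rate-Type-I singular profile ⇒ apex profile) and the tail shared
with RecurrentProfiles / TypeILiouville
(TypeIBlowupProfile = stmt-1591, NoTypeII = stmt-0056, ClayFromNoBlowup = stmt-0055).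
Lean: `∀ (u : ℝ → EuclideanSpace ℝ (Fin 3) → EuclideanSpace ℝ (Fin 3)) (p : ℝ → EuclideanSpace ℝ
(Fin 3) → ℝ) (G : ℝ → EuclideanSpace ℝ (Fin 3) → EuclideanSpace ℝ (Fin 3) →L[ℝ] EuclideanSpace ℝ
(Fin 3)) (C : ℝ), Literature.Analysis.FluidPDE.IsSuitableWeakSolutionOn
(Literature.Analysis.FluidPDE.slab (EuclideanSpace ℝ (Fin 3)) (Set.Iio 0) isOpen_Iio) 1 0 u p →
Literature.Analysis.FluidPDE.HasWeakSpatialGradientOn (Literature.Analysis.FluidPDE.slab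
(EuclideanSpace ℝ (Fin 3)) (Set.Iio 0) isOpen_Iio) u G → Literature.Analysis.FluidPDE.typeIBound
(Set.Iio (0 : ℝ) ×ˢ Set.univ) u p G < ⊤ → Literature.Analysis.FluidPDE.HasTypeIDecay C u → ¬
Literature.Analysis.FluidPDE.IsBackwardSingularPoint u 0`

## Assembly
Pure logic, PROVED sorry-free in the planner's Sketch.lean (`closes`, `target_of_cruxes`,
`assembly_holds`; lean check rc 0). Deciding
theorem `closes (ScarRigidity) (SymmetricScarExists) (ApexLocalisation) (NoTypeII)
(SimilarityCovariance) (SelfSimilarApexFatal)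
(AxisymmetricApexFatal) (TypeIBlowupProfile) (ClayFromNoBlowup) : NavierStokesRegularity`: apply
ClayFromNoBlowup; a classical Leray–Hopf
solution from a rapidly decaying datum with no smooth extension past T is maximal
(IsMaximalSmoothSolution := classical ∧ ¬extension);
NoTypeII gives the Type-I rate; TypeIBlowupProfile a rate-class profile singular at the origin;
ApexLocalisation an apex-class profile
singular at the origin; SymmetricScarExists one with a homogeneous or axisymmetric scar;
SimilarityCovariance puts each rescaling (resp.
rotation) of it in the apex class with the same scar, ScarRigidity identifies it with the profile,
and SelfSimilarApexFatal (resp.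
AxisymmetricApexFatal) yields False. The target X is obtained from ScarRigidity, SymmetricScarExists
and the three supports by the same
lines (`target_of_cruxes`), and the item below records X → Clay (A).

Rationale: WHY THIS LINE. Mechanism (card scar-rigidity-rellich-final-slice): in Leray's backward variables y =
x/√(−t), s = −log(−t) the apex becomes spatial infinity
and the profile equation ∂ₛU = ΔU − ½y·∇U − ½U − U·∇U − ∇P has OUTWARD drift; for the linear part
every s-bounded solution that is
o(|y|⁻¹) at infinity vanishes because the fast radial branch r^β e^{+r²/4} grows — Rellich's lemma
for outgoing Helmholtz fields (Rellich1943)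
read through the dictionary outgoing solution ↦ backward-similarity profile, radiation pattern ↦
scar, 'no o(r^{−(n−1)/2}) outgoing field'
↦ 'no o(|y|⁻¹) profile difference'; two apex profiles with the same scar differ by O(|y|⁻³), so the
scar should be a COMPLETE INVARIANT
(ScarRigidity = backward uniqueness with NON-trivial final data across a Type-I apex; its bounded,
regular-time version is LeiYangYuan2024 =
arXiv:2311.02429 Thm 1.1, its zero-data end is EscauriazaSereginSverak2003). With a complete
one-slice invariant, symmetry and
recurrence of the KNSS/Albritton–Barker zoom flow (KNSS2009 §6, AlbrittonBarker2019 Thm 1.1, route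
RecurrentProfiles) are read off ONE
analytic divergence-free field σ on ℝ³∖{0} with |σ| ≤ C/|x|: a homogeneous scar forces an exactly
self-similar profile (dead:
NecasRuzickaSverak1996, Tsai1998 Thm 2 = tree `tsai_selfsimilar_local_energy_holds`), an
axisymmetric scar an axisymmetric Type-I profile
(dead: SereginSverak2009 Thm 3.1 = tree `AxisymmetricTypeIExclusion_holds`). Imported areas, with
dictionary: scattering theory
(Rellich–Kato uniqueness from the far-field pattern) and parabolic unique continuation /
Carleman–A_p weights (EscauriazaSereginSverak2003,
Poon1996, LeiYangYuan2024) acting on the blow-up rescaling programme; no probabilistic or spectral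
reformulation of the datum problem (none
touches the ∀-datum supercritical gap, Tao2016AveragedNS). What no prior route does: every Type-I
route in the tree (TypeILiouville,
RecurrentProfiles, SymmetryModuliCount, ExtremalTypeIConstant, QuantisedSymmetry,
DssFarFieldSlaving) works with the space–time profile;
backward uniqueness enters the tree only with ZERO data (ESS, Lemarié-Rieusset Thm 15.4); nobody
uses the trace at the singular time as an
invariant. Negatives index: empty (0 refuted statements, 2026-08-15).

RANKED CRUXES. #0 NoApexTypeIProfile (target) — X — no suitable weak solution on ℝ³×(−∞,0) with 𝐈 <
∞ and |u(x,t)| ≤ C/(|x|+√−t) has a (backward) singular point at the origin; the KNSS (1.6) form of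
"no Type-I blow-up profile", implied by the Liouville conjecture (L) and by RecurrentProfiles'
target stmt-1588 (rate class ⊇ apex class). (why it might fail: ¬X is a Type-I blow-up profile with
an isolated apex — e.g. a backward λ-DSS local-energy solution (BradshawTsai2017CPDE Open Problem;
ChaeWolf2017RemovingDSS removes only λ≈1), the object Hou-type numerics aim at
(Hou2022PotentiallySingularNS).) [KNSS2009, AlbrittonBarker2019, ChaeWolf2017RemovingDSS,
BradshawTsai2017CPDE, Hou2022PotentiallySingularNS]
#2 ScarRigidity (crux) — SCAR RIGIDITY (card K1): two suitable weak solutions on ℝ³×(−∞,0) with 𝐈 <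
∞ and the same space–time Type-I constant C, both singular at the origin, whose difference is
essentially small near the final slice off the origin (ess sup_{(−δ,0)×K} |u₁−u₂| → 0 as δ↓0 for
every compact K ∌ 0, i.e. the same scar u₁(·,0) = u₂(·,0) on ℝ³∖{0}) coincide a.e. on the slab —
backward uniqueness with non-trivial final data across a Type-I apex; in Leray variables: an
s-bounded O(|y|⁻³) solution of the linearised difference system (coefficients U₁, ∇U₂ = O(|y|⁻¹),
O(|y|⁻²), pressure Π = RR(U₁⊗W + W⊗U₂)) vanishes. [difficulty: XL] (why it might fail: the pressure
RR(U⊗W) carries a |y|⁻³ harmonic multipole tail fed by core moments, so decay cannot be bootstrapped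
and a Carleman/weighted estimate compatible with Riesz transforms at scale-critical strength is
needed (LYY's polynomial weights work only for BOUNDED u); C may enter as a threshold.)
[LeiYangYuan2024, arXiv:2311.02429, EscauriazaSereginSverak2003, Poon1996, Rellich1943,
AlbrittonBarker2019]
#3 SymmetricScarExists (crux) — ONE-SLICE SELECTION (card Z): if for some C a singular apex profile
exists (suitable weak on the slab, 𝐈 < ∞, |u| ≤ C/(|x|+√−t), origin singular), then for some C'
there is one whose SCAR is either (−1)-homogeneous — every rescaling λu(λ²t,λx), λ>0, has the same
scar — or axisymmetric about the x₃-axis — every rotation R_θ u(t, R_θ⁻¹x) has the same scar. The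
closing bet; conceivable engines: a monotone/frequency functional for the zoom flow on the compact
set of singular apex profiles (blow-downs become homogeneous, GigaKohn1985 template), or extremal
selection of a scale-invariant functional of the scar (cf. route ExtremalTypeIConstant), made
one-slice by ScarRigidity. [deps: ScarRigidity] [difficulty: open-problem] (why it might fail: no
monotonicity formula for the Navier–Stokes zoom flow is known; minimal sets of the scaling action
need not contain fixed or SO(2)-invariant points — a large-λ Type-I DSS profile or a weakly-mixing
minimal set (RecurrentProfiles' open rungs) has no symmetric-scar member in its orbit closure.)
[GigaKohn1985, Furstenberg1981, ChaeWolf2017RemovingDSS, BradshawTsai2017CPDE, PineauVicol2026,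
AlbrittonBarker2019]
#4 ApexLocalisation (crux) — APEX LOCALISATION: if a suitable weak solution on the slab with 𝐈 < ∞
and the Type-I RATE |u| ≤ C/√−t is singular at the origin (the class produced by TypeIBlowupProfile,
stmt-1591), then some suitable weak solution on the slab with 𝐈 < ∞ and the SPACE–TIME bound |u| ≤
C'/(|x|+√−t) is singular at the origin — among the translates / zooms / limits of a rate-Type-I
singular profile there is one whose final-time singular set is scale-invariantly isolated
(equivalently: no flow in its scaling-orbit closure is singular on S²×{0}). [difficulty: L] (why it
might fail: finite-singular-set theorems need L^{3,∞} control (ChoeWolfYang2019; Barker2024: O(M^20)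
points), which the rate alone does not give; a rate-Type-I profile whose final-time singular set is
a scaling-recurrent Cantor dust (𝒫¹-null, CKN-allowed) has no apex profile in its orbit closure.)
[arXiv:2111.14776, doi:10.1007/s00208-019-01843-2, CaffarelliKohnNirenberg1982, AlbrittonBarker2019,
arXiv:1901.08842]
#5 NoTypeII (crux) — shared with TypeILiouville #2 / RecurrentProfiles #4
(stmt-NavierStokesRegularity-0056), verbatim: a maximal finite-energy classical solution from a
rapidly decaying datum blows up at the Type-I rate ‖u(t)‖_∞ ≤ C(T−t)^{−1/2}. This route adds nothing
to it and says so. [difficulty: open-problem] (why it might fail: it is ¬(Type-II blow-up): no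
theorem bounds a blow-up rate from above; Tao's averaged NS blows up at Type-II rate
(arXiv:1402.0290 p.8), and every axisymmetric singularity is Type II (KNSS2009 p.4), so Hou's
scenario, if real, refutes it.) [Tao2016AveragedNS, KNSS2009, SereginSverak2009,
Hou2022PotentiallySingularNS, Seregin2012, EscauriazaSereginSverak2003]
#9 SimilarityCovariance (support) — the apex class and the origin singularity are covariant under
Navier–Stokes rescaling and rotations about the x₃-axis: if (u,p,G) is a suitable weak solution on
the slab with 𝐈 < ∞, |u| ≤ C/(|x|+√−t) and singular origin, then so is λu(λ²t,λx) (pressure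
λ²p(λ²t,λx), gradient λ²G(λ²t,λx)) for every λ>0, and so is R_θ u(t,R_θ⁻¹x) (pressure p(t,R_θ⁻¹x),
gradient conjugated), with the same C. Bookkeeping: `HasTypeIDecay.nsRescale`, `norm_rotZ`, scale
invariance of 𝐈 and of `IsBackwardSingularPoint` at 0. [difficulty: provable-now] [KNSS2009,
CaffarelliKohnNirenberg1982, AlbrittonBarker2019]
#9 SelfSimilarApexFatal (support) — an apex profile singular at the origin cannot be a.e.
self-similar (u = λu(λ²·,λ·) a.e. for every λ>0): bounded for t ≤ −δ hence smooth on the open slab,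
it is then exactly self-similar, u = lerayBackward (1/2) 0 U with a C^∞ Leray profile (U,P), and the
local energy bounds A, E ≤ 𝐈 < ∞ on Q((0,0),1) feed Tsai1998 Thm 2 (tree:
`tsai_selfsimilar_local_energy_holds`, PROVED) ⇒ U = 0 ⇒ u = 0, not singular. Known; the work is
representative/regularity bookkeeping. [difficulty: M] [Tsai1998, NecasRuzickaSverak1996,
Literature.Analysis.FluidPDE.tsai_selfsimilar_local_energy_holds]
#9 AxisymmetricApexFatal (support) — an apex profile singular at the origin cannot be a.e.
axisymmetric (R_θ u(t,R_θ⁻¹·) = u a.e. for every θ): averaging over θ gives an exactly axisymmetric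
representative, a distributional solution on the unit cylinder with u ∈ L³, p ∈ L^{3/2} and √(−t)|u|
≤ C a.e., so SereginSverak2009 Thm 3.1 (tree:
`Literature.Barriers.NavierStokesRegularity.AxisymmetricTypeIExclusion_holds`, PROVED) makes the
origin regular — contradiction. Known; bookkeeping (Haar averaging lemma, restriction of the
suitable class to the cylinder). [difficulty: M] [SereginSverak2009, KNSS2009,
Literature.Barriers.NavierStokesRegularity.AxisymmetricTypeIExclusion]
#9 TypeIBlowupProfile (support) — shared with RecurrentProfiles (stmt-NavierStokesRegularity-1591),
verbatim: a Type-I-RATE blow-up of a maximal finite-energy classical solution from a rapidly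
decaying datum yields a suitable weak solution on the slab with 𝐈 < ∞, rate constant C and a
singular origin (ν-normalisation, singular point at T_max, AlbrittonBarker2019 Lemma 2.5 'weak
Serrin ⇒ Type I', zoom-in with SuitableCompactness_holds / PersistenceOfSingularities_holds).
[difficulty: L] [AlbrittonBarker2019, KNSS2009, SereginSverak2009, RusinSverak2011, Lin1998]
#9 ClayFromNoBlowup (support) — shared assembly tail (stmt-NavierStokesRegularity-0055), verbatim:
no finite-time blow-up for finite-energy classical solutions from rapidly decaying data ⇒ Clay (A)
(local classical theory, continuation, weak–strong uniqueness, far-field ε-regularity, energy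
inequality). [difficulty: L] [KNSS2009, CaffarelliKohnNirenberg1982, LemarieRieusset2016]
#9 NoMildScar (support) — NO MILD SCAR UNDER TYPE I (card P1, unconditional output; not used by
`closes`): the scar of an apex profile singular at the origin is not in L³ near the origin — no σ ∈
L³(B_r) satisfies ess sup_{(−δ,0)×K} |u − σ| → 0 (δ↓0) for all compact K ∌ 0. Proof sketch (checked
informally): if σ ∈ L³(B_r) were the scar, zooms u_λ (λ→0) have scars λσ(λ·) → 0 in L³_loc; a limit
ū (SuitableCompactness_holds, uniform Hölder bounds off 0 from |u_λ| ≤ C/|x|) is an apex profile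
singular at 0 (PersistenceOfSingularities_holds) with ZERO scar; ESS exterior backward uniqueness
for ω̄ on (ℝ³∖B_R)×(−1,0) (tree `ess_backward_uniqueness_holds`) + parabolic unique continuation ⇒
ω̄ ≡ 0 ⇒ ū(t) harmonic, decaying ⇒ ū ≡ 0, contradicting the singularity. The auditor's 'land P1
first'. [difficulty: L] [EscauriazaSereginSverak2003, AlbrittonBarker2019, arXiv:1811.00502,
Seregin2012, LemarieRieusset2016]

TWO-LAYER PLAN. Foreseen glued splits (k ≤ 3, depth 1), filed only after a crux moves: ScarRigidity
⇐ LinearRellichExterior (card P2, exterior/UC-at-infinity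
form as the auditor asked: s-bounded solutions of ∂ₛW = ΔW − ½y·∇W − ½W [+ Stokes pressure] on
(ℝ³∖B_R)×ℝ with W = o(|y|⁻¹), ∇W = o(|y|⁻²)
vanish) → DifferenceDecay (two apex profiles with the same scar differ by O(|y|⁻³) with s-uniform
bounds) → NonlinearAbsorption (weighted
estimate absorbing U·∇W, W·∇U and RR(U⊗W)) → ScarRigidity. SymmetricScarExists ⇐ ScarMapContinuous
(scar map continuous and injective on the
compact set of singular apex profiles, hence a conjugacy of the zoom flow with the log-radial shift
on scars) → OneSliceSelection (fixed or
SO(2)-invariant point of the shift on the scar set) → SymmetricScarExists; a third alternative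
'λ-DSS scar with λ < λ_*(C)' killed by
ChaeWolf2017RemovingDSS Thm 1.3 may be added as a widening. ApexLocalisation ⇐ OrbitClosureDichotomy
(apex bound ⇔ no orbit-closure flow
singular on S²×{0}) → FinalSliceSparsity → ApexLocalisation.

KILL CRITERIA. (i) The card's cheapest falsifier run with pressure: an explicit s-bounded (periodic
or tempered) solution of the LINEARISED difference system
around a Type-I-like profile (e.g. Landau U_b in backward variables), or of the exterior
Stokes–Ornstein–Uhlenbeck system, decaying like
|y|⁻³ — kills the Rellich mechanism; close `refuted:ScarRigidity` unless a nonlinear obstruction is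
named. (ii) Two distinct singular apex
profiles with a common scar (¬ScarRigidity outright). (iii) A Type-I profile (DSS, Hou-type, or any)
whose orbit closure has no symmetric-scar
member refutes SymmetricScarExists and, being ¬X, settles the target negatively: close
`refuted:SymmetricScarExists`; ScarRigidity and
NoMildScar survive as Literature-grade statements (hand to CertifiedBlowup as design constraints:
the certified profile's far-field pattern
must be non-L³, log-corrugated, non-axisymmetric). (iv) A Schwartz-data Type-II blow-up refutes
NoTypeII (= ¬Clay A; shared fate with
TypeILiouville). (v) ApexLocalisation refuted by a Cantor-dust Type-I profile ⇒ pivot: restate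
ScarRigidity/SymmetricScarExists over
profiles with finitely many final-time singular points (Barker2024 class). Mooted if NoBlowup
(stmt-0054), (L) (stmt-0057) or
RecurrentProfiles' NoTypeIRateProfile (stmt-1588, which implies X) is proved.

NOT DECOMPOSED YET. The linear lemma P2 and the weighted estimate inside ScarRigidity (layer 2
above); the continuity of the scar map and the compactness of the
apex class (inside SymmetricScarExists / NoMildScar proofs: SuitableCompactness_holds + uniform
ε-regularity off the origin); the Haar-averaging
and smooth-representative lemmas inside the two Fatal supports; the ν-normalisation and A–B Lemma
2.5 inside TypeIBlowupProfile (shared);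
anything about Type II; the DSS (K2) and one-slice-ESS-without-Type-I (K3) statements of the card —
K3 is probably shared with averaged
equations and is deliberately NOT filed.

CHEAPEST FALSIFIER. The 30-line symbolic check the card names and could not run (searchd/kit down in
its session): for the vorticity/Stokes form of
L = ∂ₛ − Δ + ½y·∇ + ½ with pressure, solve per harmonic ℓ and time-frequency μ the radial ODE v″ +
(2/r)v′ − ℓ(ℓ+1)v/r² − ½rv′ − (1+iμ)v = 0 and
confirm that the solution regular at 0 always carries a non-zero slow component r^{−2−2iμ} (else it
is the e^{r²/4} branch) and that
divergence-free reconstruction adds only harmonic gradients excluded by decay. If a decaying regular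
mode exists, ScarRigidity's mechanism is
dead at the linear level. Not run here (planner; kit not used): it is the first thing a refuter
should do (kit sympy/mpmath job), together
with the literature check 'is Type-I-apex backward uniqueness with non-trivial data already claimed
or refuted?' (zbMATH 2026-08-15: only
LeiYangYuan2024, bounded case).

NUMBERS. Zero-scar end: ESS 2003 (exterior backward uniqueness, tree
`ess_backward_uniqueness_holds`); bounded non-trivial-data end: LeiYangYuan2024
Thm 1.1 (bounded mild, bounded vorticity, polynomial weights ⟨x⟩^{−k}). Liouville kills available in
tree for the symmetric alternatives:
self-similar (Tsai1998 Thm 2, proved), axisymmetric Type I (SereginSverak2009 Thm 3.1, proved),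
λ-DSS only for λ ∈ (1, λ_*(C))
(ChaeWolf2017RemovingDSS Thm 1.3, fact). Singular-point counts: O(M^20) at the final time under
sup_n ‖u(s_n)‖_{L^{3,∞}} ≤ M (Barker2024),
finite under L^∞_t L^{3,w}_x (ChoeWolfYang2019); nothing under the rate alone. Items at open: 12
(target, 4 cruxes incl. 1 shared, 6
supports incl. 2 shared, assembly); new decls 8; Sketch.lean rc 0, 0 sorries.

DEFINITION REQUESTS. None required: the scar is rendered inline (ess-sup smallness of the difference
on (−δ,0)×K). A Literature notion `FinalTrace u`
(trace of a slab solution at t = 0 off a closed set) would shorten the signatures of ScarRigidity /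
SymmetricScarExists / NoMildScar and
may be requested by a grounder; `HasTypeIDecay`, `typeIBound`, `IsBackwardSingularPoint`,
`nsRescale`, `rotZ` exist. CONE (route-repair 2026-08-15, planner-rrepair-…-1fadd6c7-0): needs-fact:
NONE. The 8 undischarged closed facts the priority reconciler counts in this file's import cone —
Literature.Analysis.FluidPDE.tao_quantitative_ess, .tao_L3_blowup_rate (Tao2021 Thms 1.2/1.4),
.TypeISingularityExists, .NontrivialTypeIAncientExists, .LocalTypeISingularityExists,
.NontrivialMildAncientTypeIExists (registered OPEN statements, [status: open]: never dischargeable;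
the target NoApexTypeIProfile is morally their negation), .AlbrittonBarkerTypeICharacterization (A–B
Thm 1.1; not used — TypeIBlowupProfile re-derives the forward zoom it needs) + one unlisted — are
used by NO item, NOT by `closes` (gate decl-level deps: 0 unproved of 57 constants). They ride in on
the single import `LocalTypeI` (→ PartialRegularity), which this route and 8 sibling Type-I routes
need only for the DEFINITIONS `typeIBound`, `IsBackwardSingularPoint` and the DISCHARGED facts
SuitableCompactness_holds / PersistenceOfSingularities_holds; no import is droppable with effect and
no crux was restated (an inline unfolding of 𝐈 over SuitableWeak primitives would de-share stmt-1591
and be undone by the first linked proof module, all of which import PartialRegularity). Durable fix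
filed as ledger item defn-TypeIConjectures (move the 7 facts into TypeIConjectures.lean /
TaoQuantitativeStatements.lean, names unchanged); census-side, [status: open] facts should park as
open-problem.

Novelty: Searches (2026-08-15; searchd/hybrid rc 75 all session, OpenAlex 429, arXiv 429): zbMATH 'backward
uniqueness Navier-Stokes final data' (3:
LeiYangYuan2024 = arXiv:2311.02429, read pp.1–3: Thm 1.1, Example 1.2, question (Q)); zbMATH 'number
of singular points Navier-Stokes Type I'
(8: Barker2024 = arXiv:2111.14776, read p.1: O(M^20) points under L^{3,∞}); zbMATH 'Seregin Type I
blowups suitable weak solutions' (1: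
arXiv:1901.08842); zbMATH 'unique continuation at infinity parabolic Ornstein-Uhlenbeck' (0),
'Landis type unique continuation Navier-Stokes
decay' (0), 'Navier-Stokes blow-up profile final time trace isolated singularity' (0), 'self-similar
singularity Navier-Stokes profile
uniqueness far field asymptotics' (0); crossref 'Choe Wolf Yang L^{3,w}' (1:
doi:10.1007/s00208-019-01843-2); `lit galaxy search
"backward uniqueness Navier-Stokes Type I singularity final time profile" --star all` (0 rows); `lit
frontier NavierStokesRegularity --since
2023` (30 rows: forward self-similar 2-D, non-uniqueness, Hou FoCM 2026; none on final-slice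
rigidity); `ledger negatives` (0); all 58
Theses headers of the sub-problem grepped for backward-uniqueness/scar/final-slice (only zero-data
ESS uses). Plus the card's own log and its
audit AUDIT-17-g3 (zbMATH/crossref sweeps, NOT FOUND: scar as complete invariant; Rellich dictionary
for backward similarity variables).
Nearest prior art found: LeiYangYuan2024 (arXiv:2311.02429) Thm 1.1 — backward uniqueness with
non-trivial final data for  [refs: 10.1007/s00208-019-01843-2, 2311.02429, 2111.14776, 1901.08842, doi:10.1007/s00208-019-01843-2, LeiYangYuan2024, Barker2024, EscauriazaSereginSverak2003]

Barriers (technique_class: backward-uniqueness rellich-rigidity liouville-rigidity): - technique_class: backward-uniqueness rellich-rigidity liouville-rigidity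
- Literature.Barriers.NavierStokesRegularity.TaoAveragedBlowup: ScarRigidity, NoMildScar and the
Fatal supports rest on the exact vorticity transport / pointwise Type-I structure and on ESS-type
backward uniqueness — the evasion Tao himself lists (evasions_known) —, not on abstract bilinear
estimates; NOT evaded for NoTypeII (Tao's blow-up is Type II; shared bet: fine structure) nor
claimed for SymmetricScarExists, whose engines must use NS-specific structure (a monotone zoom
functional would not survive averaging).
- Literature.Barriers.NavierStokesRegularity.EnergySupercriticality: not engaged by ScarRigidity /
ApexLocalisation / SymmetricScarExists (scale-invariant statements inside the Type-I class; the
energy is never the coercive quantity); fully faced by NoTypeII exactly as recorded on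
TypeILiouville.
- Literature.Barriers.NavierStokesRegularity.LeraySelfSimilarBlowupExclusion: USED, not evaded — it
is the kill of the homogeneous-scar alternative (SelfSimilarApexFatal via
tsai_selfsimilar_local_energy_holds); its evasions_known (DSS, asymptotically self-similar) are
precisely what SymmetricScarExists must still select against.
- Literature.Barriers.NavierStokesRegularity.AxisymmetricTypeIExclusion: USED as the kill of the
axisymmetric-scar alternative (AxisymmetricApexFatal); scope caveat (a) respected: the apex class
restricts to the unit cylinder with u ∈ L³, p ∈ L^{3/2}, a.e. Type-I bound.
-

Novelty grade: new-combination — route-review grade (refuter rreview-0815T18-6; concurs with audits 17-g3 and 22 of the card): NEW-COMBINATION = [ESS exterior backward uniqueness / LYY 2024 non-trivial-data backward uniqueness] × [applied ACROSS a Type-I apex, trace at the singular time as the invariant] + the symmetric-selection c (refuter refuter-rreview-0815T18-6-0, 2026-08-15T19:20:55Z; prior: EscauriazaSereginSverak2003 (exterior backward uniqueness, zero data) = the linear layer verbatim, arXiv:2311.02429 LeiYangYuan2024 Thm 1.1 (backward uniqueness, non-trivial data, bounded mild), EKPV MRL 2006 (UC from infinity for heat + lower order; audit-22), Tsai1998 Thm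 2 / SereginSverak2009 Thm 3.1 (the two Liouville kills, proved in tree), doi:10.3934/dcdss.2013.6.1391 Neustupa 2013; arXiv:1)

History (route lifecycle, newest last):
- 2026-09-04T10:53:48Z · DORMANT — reconciler: no traction for 5 d (last activity statement-claimed at 2026-08-30T10:20:50Z); parked, not closed — `ledger route dormant route-NavierStokesRegulari (operator:999:3970794)

sub-problem: NavierStokesRegularity · status: dormant · opened planner-plancard-NavierStokesRegularity-Navie-4478d59f-0 2026-08-15T18:38:01Z · rev 2 · ledger route-NavierStokesRegularity-RellichScar
GENERATED by the gate from the ledger (D-0016/17). Provers cite these decls: `theorem foo : Summit.NavierStokesRegularity.NavierStokesRegularity.Theses.RellichScar.<Decl> := …` in Summits/NavierStokesRegularity/NavierStokesRegularity/Theorems/<Name>.lean.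
-/

namespace Summit.NavierStokesRegularity.NavierStokesRegularity.Theses.RellichScar

open scoped BigOperators Topology Manifold Classical MeasureTheory ProbabilityTheory Matrix InnerProductSpace ComplexConjugate ContinuousMap
open Filter Set Function TopologicalSpace MeasureTheory

attribute [summit_statement] _root_.NavierStokesRegularity

open Literature.NS

/-- item stmt-NavierStokesRegularity-11716 · target · rank 0 · open · by planner
why it might fail: ¬X is a Type-I blow-up profile with an isolated apex — e.g. a backward λ-DSS local-energy solution (BradshawTsai2017CPDE Open Problem; ChaeWolf2017RemovingDSS removes only λ≈1), the object Hou-type numerics aim at (Hou2022PotentiallySingularNS).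
sources: KNSS2009, AlbrittonBarker2019, ChaeWolf2017RemovingDSS, BradshawTsai2017CPDE, Hou2022PotentiallySingularNS
[target] X — no suitable weak solution on ℝ³×(−∞,0) with 𝐈 < ∞ and |u(x,t)| ≤ C/(|x|+√−t) has a
(backward) singular point at the origin; the KNSS (1.6) form of "no Type-I blow-up profile", implied
by the Liouville conjecture (L) and by RecurrentProfiles' target stmt-1588 (rate class ⊇ apex
class). -/
@[route_item "route-NavierStokesRegularity-RellichScar"]
def NoApexTypeIProfile : Prop :=
  ∀ (u : ℝ → EuclideanSpace ℝ (Fin 3) → EuclideanSpace ℝ (Fin 3)) (p : ℝ → EuclideanSpace ℝ (Fin 3) → ℝ) (G : ℝ → EuclideanSpace ℝ (Fin 3) → EuclideanSpace ℝ (Fin 3) →L[ℝ] EuclideanSpace ℝ (Fin 3)) (C : ℝ), Literature.Analysis.FluidPDE.IsSuitableWeakSolutionOn (Literature.Analysis.FluidPDE.slab (EuclideanSpace ℝ (Fin 3)) (Set.Iio 0) isOpen_Iio) 1 0 u p → Literature.Analysis.FluidPDE.HasWeakSpatialGradientOn (Literature.Analysis.FluidPDE.slab (EuclideanSpace ℝ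 (Fin 3)) (Set.Iio 0) isOpen_Iio) u G → Literature.Analysis.FluidPDE.typeIBound (Set.Iio (0 : ℝ) ×ˢ Set.univ) u p G < ⊤ → Literature.Analysis.FluidPDE.HasTypeIDecay C u → ¬ Literature.Analysis.FluidPDE.IsBackwardSingularPoint u 0

/-- item stmt-NavierStokesRegularity-11717 · crux · rank 2 · open · by planner
why it might fail: the pressure RR(U⊗W) carries a |y|⁻³ harmonic multipole tail fed by core moments, so decay cannot be bootstrapped and a Carleman/weighted estimate compatible with Riesz transforms at scale-critical strength is needed (LYY's polynomial weights work only for BOUNDED u); C may enter as a threshold.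
sources: LeiYangYuan2024, EscauriazaSereginSverak2003, Poon1996, Rellich1943, AlbrittonBarker2019
[crux] SCAR RIGIDITY (card K1): two suitable weak solutions on ℝ³×(−∞,0) with 𝐈 < ∞ and the same
space–time Type-I constant C, both singular at the origin, whose difference is essentially small
near the final slice off the origin (ess sup_{(−δ,0)×K} |u₁−u₂| → 0 as δ↓0 for every compact K ∌ 0,
i.e. the same scar u₁(·,0) = u₂(·,0) on ℝ³∖{0}) coincide a.e. on the slab — backward uniqueness with
non-trivial final data across a Type-I apex; in Leray variables: an s-bounded O(|y|⁻³) solution of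
the linearised difference system (coefficients U₁, ∇U₂ = O(|y|⁻¹), O(|y|⁻²), pressure Π = RR(U₁⊗W +
W⊗U₂)) vanishes. [difficulty: XL] -/
@[route_item "route-NavierStokesRegularity-RellichScar"]
def ScarRigidity : Prop :=
  ∀ (u₁ : ℝ → EuclideanSpace ℝ (Fin 3) → EuclideanSpace ℝ (Fin 3)) (p₁ : ℝ → EuclideanSpace ℝ (Fin 3) → ℝ) (G₁ : ℝ → EuclideanSpace ℝ (Fin 3) → EuclideanSpace ℝ (Fin 3) →L[ℝ] EuclideanSpace ℝ (Fin 3)) (u₂ : ℝ → EuclideanSpace ℝ (Fin 3) → EuclideanSpace ℝ (Fin 3)) (p₂ : ℝ → EuclideanSpace ℝ (Fin 3) → ℝ) (G₂ : ℝ → EuclideanSpace ℝ (Fin 3) → EuclideanSpace ℝ (Fin 3) →L[ℝ] EuclideanSpace ℝ (Fin 3)) (C : ℝ), Literature.Analysis.FluidPDE.IsSuitableWeakSolutionOn (Literature.Analysis.FluidPDE.slab (EuclideanSpace ℝ (Fin 3)) (Set.Iio 0) isOpen_Iio) 1 0 u₁ p₁ → Literature.Analysis.FluidPDE.HasWeakSpatialGradientOn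 (Literature.Analysis.FluidPDE.slab (EuclideanSpace ℝ (Fin 3)) (Set.Iio 0) isOpen_Iio) u₁ G₁ → Literature.Analysis.FluidPDE.typeIBound (Set.Iio (0 : ℝ) ×ˢ Set.univ) u₁ p₁ G₁ < ⊤ → Literature.Analysis.FluidPDE.HasTypeIDecay C u₁ → Literature.Analysis.FluidPDE.IsSuitableWeakSolutionOn (Literature.Analysis.FluidPDE.slab (EuclideanSpace ℝ (Fin 3)) (Set.Iio 0) isOpen_Iio) 1 0 u₂ p₂ → Literature.Analysis.FluidPDE.HasWeakSpatialGradientOn (Literature.Analysis.FluidPDE.slab (EuclideanSpace ℝ (Fin 3)) (Set.Iio 0) isOpen_Iio) u₂ G₂ → Literature.Analysis.FluidPDE.typeIBound (Set.Iio (0 : ℝ) ×ˢ Set.univ) u₂ p₂ G₂ < ⊤ → Literature.Analysis.FluidPDE.HasTypeIDecay C u₂ → Literature.Analysis.FluidPDE.IsBackwardSingularPoint u₁ 0 → Literature.Analysis.FluidPDE.IsBackwardSingularPoint u₂ 0 → (∀ K : Set (EuclideanSpace ℝ (Fin 3)), IsCompact K → (0 : EuclideanSpace ℝ (Fin 3))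 ∉ K → Filter.Tendsto (fun δ : ℝ => MeasureTheory.eLpNorm (Function.uncurry u₁ - Function.uncurry u₂) ⊤ (MeasureTheory.volume.restrict (Set.Ioo (-δ) 0 ×ˢ K))) (nhdsWithin 0 (Set.Ioi 0)) (nhds 0)) → Function.uncurry u₁ =ᵐ[MeasureTheory.volume.restrict (Set.Iio (0 : ℝ) ×ˢ Set.univ)] Function.uncurry u₂

/-- item stmt-NavierStokesRegularity-11718 · crux · rank 3 · open · by planner
why it might fail: no monotonicity formula for the Navier–Stokes zoom flow is known; minimal sets of the scaling action need not contain fixed or SO(2)-invariant points — a large-λ Type-I DSS profile or a weakly-mixing minimal set (RecurrentProfiles' open rungs) has no symmetric-scar member in its orbit closure.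
sources: GigaKohn1985, Furstenberg1981, ChaeWolf2017RemovingDSS, BradshawTsai2017CPDE, PineauVicol2026, AlbrittonBarker2019
[crux] ONE-SLICE SELECTION (card Z): if for some C a singular apex profile exists (suitable weak on
the slab, 𝐈 < ∞, |u| ≤ C/(|x|+√−t), origin singular), then for some C' there is one whose SCAR is
either (−1)-homogeneous — every rescaling λu(λ²t,λx), λ>0, has the same scar — or axisymmetric about
the x₃-axis — every rotation R_θ u(t, R_θ⁻¹x) has the same scar. The closing bet; conceivable
engines: a monotone/frequency functional for the zoom flow on the compact set of singular apex
profiles (blow-downs become homogeneous, GigaKohn1985 template), or extremal selection of a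
scale-invariant functional of the scar (cf. route ExtremalTypeIConstant), made one-slice by
ScarRigidity. [deps: ScarRigidity] [difficulty: open-problem] -/
@[route_item "route-NavierStokesRegularity-RellichScar"]
def SymmetricScarExists : Prop :=
  ∀ C : ℝ, (∃ (u : ℝ → EuclideanSpace ℝ (Fin 3) → EuclideanSpace ℝ (Fin 3)) (p : ℝ → EuclideanSpace ℝ (Fin 3) → ℝ) (G : ℝ → EuclideanSpace ℝ (Fin 3) → EuclideanSpace ℝ (Fin 3) →L[ℝ] EuclideanSpace ℝ (Fin 3)), Literature.Analysis.FluidPDE.IsSuitableWeakSolutionOn (Literature.Analysis.FluidPDE.slab (EuclideanSpace ℝ (Fin 3)) (Set.Iio 0) isOpen_Iio) 1 0 u p ∧ Literature.Analysis.FluidPDE.HasWeakSpatialGradientOn (Literature.Analysis.FluidPDE.slab (EuclideanSpace ℝ (Fin 3)) (Set.Iio 0) isOpen_Iio) u G ∧ Literature.Analysis.FluidPDE.typeIBound (Set.Iio (0 : ℝ) ×ˢ Set.univ) u p G < ⊤ ∧ Literature.Analysis.FluidPDE.HasTypeIDecay C u ∧ Literature.Analysis.FluidPDE.IsBackwardSingularPoint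 u 0) → ∃ (C' : ℝ) (u : ℝ → EuclideanSpace ℝ (Fin 3) → EuclideanSpace ℝ (Fin 3)) (p : ℝ → EuclideanSpace ℝ (Fin 3) → ℝ) (G : ℝ → EuclideanSpace ℝ (Fin 3) → EuclideanSpace ℝ (Fin 3) →L[ℝ] EuclideanSpace ℝ (Fin 3)), Literature.Analysis.FluidPDE.IsSuitableWeakSolutionOn (Literature.Analysis.FluidPDE.slab (EuclideanSpace ℝ (Fin 3)) (Set.Iio 0) isOpen_Iio) 1 0 u p ∧ Literature.Analysis.FluidPDE.HasWeakSpatialGradientOn (Literature.Analysis.FluidPDE.slab (EuclideanSpace ℝ (Fin 3)) (Set.Iio 0) isOpen_Iio) u G ∧ Literature.Analysis.FluidPDE.typeIBound (Set.Iio (0 : ℝ) ×ˢ Set.univ) u p G < ⊤ ∧ Literature.Analysis.FluidPDE.HasTypeIDecay C' u ∧ Literature.Analysis.FluidPDE.IsBackwardSingularPoint u 0 ∧ ((∀ lam : ℝ, 0 < lam → (∀ K : Set (EuclideanSpace ℝ (Fin 3)), IsCompact K → (0 : EuclideanSpace ℝ (Fin 3)) ∉ K → Filter.Tendsto (fun δ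 : ℝ => MeasureTheory.eLpNorm (Function.uncurry (Literature.Analysis.FluidPDE.nsRescale lam u) - Function.uncurry u) ⊤ (MeasureTheory.volume.restrict (Set.Ioo (-δ) 0 ×ˢ K))) (nhdsWithin 0 (Set.Ioi 0)) (nhds 0))) ∨ (∀ θ : ℝ, (∀ K : Set (EuclideanSpace ℝ (Fin 3)), IsCompact K → (0 : EuclideanSpace ℝ (Fin 3)) ∉ K → Filter.Tendsto (fun δ : ℝ => MeasureTheory.eLpNorm (Function.uncurry (fun t x => Literature.Analysis.FluidPDE.rotZ θ (u t (Literature.Analysis.FluidPDE.rotZ (-θ) x))) - Function.uncurry u) ⊤ (MeasureTheory.volume.restrict (Set.Ioo (-δ) 0 ×ˢ K))) (nhdsWithin 0 (Set.Ioi 0)) (nhds 0))))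

/-- item stmt-NavierStokesRegularity-11719 · crux · rank 4 · open · by planner
why it might fail: finite singular-point counts need L^∞_t L^{3,∞}_x (ChoeWolfYang2019, arXiv:1906.06707, Barker2024), which the rate + 𝐈<∞ (Morrey-type) do not give; a rate-Type-I profile whose final-time singular set is a scaling-recurrent Cantor dust (𝒫¹-null, CKN-allowed) has no apex profile in its orbit closure
sources: ChoeWolfYang2019, arXiv:1906.06707, Barker2024, BarkerPrange2020, CaffarelliKohnNirenberg1982, AlbrittonBarker2019
[crux] APEX LOCALISATION: if a suitable weak solution on the slab with 𝐈 < ∞ and the Type-I RATE |u|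
≤ C/√−t is singular at the origin (the class produced by TypeIBlowupProfile, stmt-1591), then some
suitable weak solution on the slab with 𝐈 < ∞ and the SPACE–TIME bound |u| ≤ C'/(|x|+√−t) is
singular at the origin — among the translates / zooms / limits of a rate-Type-I singular profile
there is one whose final-time singular set is scale-invariantly isolated (equivalently: no flow in
its scaling-orbit closure is singular on S²×{0}). [difficulty: L] -/
@[route_item "route-NavierStokesRegularity-RellichScar"]
def ApexLocalisation : Prop :=
  ∀ C : ℝ, (∃ (u : ℝ → EuclideanSpace ℝ (Fin 3) → EuclideanSpace ℝ (Fin 3)) (p : ℝ → EuclideanSpace ℝ (Fin 3) → ℝ) (G : ℝ → EuclideanSpace ℝ (Fin 3) → EuclideanSpace ℝ (Fin 3) →L[ℝ] EuclideanSpace ℝ (Fin 3)), Literature.Analysis.FluidPDE.IsSuitableWeakSolutionOn (Literature.Analysis.FluidPDE.slab (EuclideanSpace ℝ (Fin 3)) (Set.Iio 0) isOpen_Iio) 1 0 u p ∧ Literature.Analysis.FluidPDE.HasWeakSpatialGradientOn (Literature.Analysis.FluidPDE.slab (EuclideanSpace ℝ (Fin 3)) (Set.Iio 0) isOpen_Iio)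 u G ∧ Literature.Analysis.FluidPDE.typeIBound (Set.Iio (0 : ℝ) ×ˢ Set.univ) u p G < ⊤ ∧ Literature.Analysis.FluidPDE.HasTypeITimeDecay C u ∧ Literature.Analysis.FluidPDE.IsBackwardSingularPoint u 0) → ∃ (C' : ℝ) (u : ℝ → EuclideanSpace ℝ (Fin 3) → EuclideanSpace ℝ (Fin 3)) (p : ℝ → EuclideanSpace ℝ (Fin 3) → ℝ) (G : ℝ → EuclideanSpace ℝ (Fin 3) → EuclideanSpace ℝ (Fin 3) →L[ℝ] EuclideanSpace ℝ (Fin 3)), Literature.Analysis.FluidPDE.IsSuitableWeakSolutionOn (Literature.Analysis.FluidPDE.slab (EuclideanSpace ℝ (Fin 3)) (Set.Iio 0) isOpen_Iio) 1 0 u p ∧ Literature.Analysis.FluidPDE.HasWeakSpatialGradientOn (Literature.Analysis.FluidPDE.slab (EuclideanSpace ℝ (Fin 3)) (Set.Iio 0) isOpen_Iio) u G ∧ Literature.Analysis.FluidPDE.typeIBound (Set.Iio (0 : ℝ) ×ˢ Set.univ) u p G < ⊤ ∧ Literature.Analysis.FluidPDE.HasTypeIDecay C' u ∧ Literature.Analysis.FluidPDE.IsBackwardSingularPoint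 u 0

/-- item stmt-NavierStokesRegularity-0056 · crux · rank 5 · open · by planner
why it might fail: it is ¬(Type-II blow-up): no theorem bounds a blow-up rate from above; Tao's averaged NS blows up at Type-II rate (arXiv:1402.0290 p.8), and every axisymmetric singularity is Type II (KNSS2009 p.4), so Hou's scenario, if real, refutes it.
sources: Tao2016AveragedNS, KNSS2009, SereginSverak2009, Hou2022PotentiallySingularNS, Seregin2012, EscauriazaSereginSverak2003
If a finite-energy classical solution from a rapidly decaying datum has maximal lifespan T<∞ (no
classical extension past T), then ‖u(t)‖_∞ ≤ C (T−t)^{-1/2} eventually as t↑T (Leray's rate is the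
matching lower bound, leray_blowup_rate_top). The hardest and most informative crux: a
counterexample is a Type II singularity, i.e. ¬(Clay A). Known: lower bound c√ν (T−t)^{-1/2} (Leray
1934 §20); L³ must blow up (ESS 2003, Seregin 2012); only triple-log quantitative gain (Tao 2021). -/
@[route_item "route-NavierStokesRegularity-RellichScar"]
def NoTypeII : Prop :=
  ∀ (ν T : ℝ), 0 < ν → 0 < T → ∀ (u : ℝ → EuclideanSpace ℝ (Fin 3) → EuclideanSpace ℝ (Fin 3)) (p : ℝ → EuclideanSpace ℝ (Fin 3) → ℝ), Literature.Analysis.FluidPDE.IsMaximalSmoothSolution ν 0 u p T → Literature.Analysis.FluidPDE.IsLerayHopfOn T ν 0 (u 0) u → Literature.Analysis.FluidPDE.HasRapidSpatialDecay (u 0) → Literature.Analysis.FluidPDE.IsTypeIBlowup u T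

/-- item stmt-NavierStokesRegularity-0055 · support · rank 9 · closed · proved by Summit.NavierStokesRegularity.NavierStokesRegularity.Theorems.typeICertificateLadder_noBlowupToClay_proof @ 8d57e70af7e2 (prover) · by planner
sources: KNSS2009, CaffarelliKohnNirenberg1982, LemarieRieusset2016
Given NoBlowup, build the Clay (A) solution: local finite-energy classical solution for smooth
divergence-free rapidly decaying data (Leray 1934 §III / Fujita–Kato 1964 + LPS smoothing), continue
past every T using NoBlowup, glue by weak–strong uniqueness (Prodi–Serrin), bounded energy from the
energy inequality, and convert with
Literature.Analysis.FluidPDE.isNavierStokesSolution_and_smooth_iff. Blow-up at spatial infinity is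
excluded by CKN ε-regularity applied far out. May take named Literature facts (leray_existence_R3,
ladyzhenskaya_prodi_serrin, weak_strong_uniqueness, fujita_kato_local) as hypotheses if the grounder
so rules. -/
@[route_item "route-NavierStokesRegularity-RellichScar"]
def ClayFromNoBlowup : Prop :=
  (∀ (ν T : ℝ), 0 < ν → 0 < T → ∀ (u : ℝ → EuclideanSpace ℝ (Fin 3) → EuclideanSpace ℝ (Fin 3)) (p : ℝ → EuclideanSpace ℝ (Fin 3) → ℝ), Literature.Analysis.FluidPDE.IsClassicalNSSolutionOn (Set.Ico 0 T) ν 0 u p → Literature.Analysis.FluidPDE.IsLerayHopfOn T ν 0 (u 0) u → Literature.Analysis.FluidPDE.HasRapidSpatialDecay (u 0) → Literature.Analysis.FluidPDE.HasSmoothExtensionPast ν 0 u T) → NavierStokesRegularity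

/-- `ClayFromNoBlowup` holds: proved by `Summit.NavierStokesRegularity.NavierStokesRegularity.Theorems.typeICertificateLadder_noBlowupToClay_proof` @ 8d57e70af7e2. -/
theorem ClayFromNoBlowup_holds : ClayFromNoBlowup := _root_.Summit.NavierStokesRegularity.NavierStokesRegularity.Theorems.typeICertificateLadder_noBlowupToClay_proof

/-- item stmt-NavierStokesRegularity-11720 · support · rank 9 · closed · proved by Summit.NavierStokesRegularity.NavierStokesRegularity.Theorems.RellichScarSimilarityCovariance.similarityCovariance_proof (prover) · by planner
sources: KNSS2009, CaffarelliKohnNirenberg1982, AlbrittonBarker2019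
[support] the apex class and the origin singularity are covariant under Navier–Stokes rescaling and
rotations about the x₃-axis: if (u,p,G) is a suitable weak solution on the slab with 𝐈 < ∞, |u| ≤
C/(|x|+√−t) and singular origin, then so is λu(λ²t,λx) (pressure λ²p(λ²t,λx), gradient λ²G(λ²t,λx))
for every λ>0, and so is R_θ u(t,R_θ⁻¹x) (pressure p(t,R_θ⁻¹x), gradient conjugated), with the same
C. Bookkeeping: `HasTypeIDecay.nsRescale`, `norm_rotZ`, scale invariance of 𝐈 and of
`IsBackwardSingularPoint` at 0. [difficulty: provable-now] -/
@[route_item "route-NavierStokesRegularity-RellichScar"]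
def SimilarityCovariance : Prop :=
  ∀ (u : ℝ → EuclideanSpace ℝ (Fin 3) → EuclideanSpace ℝ (Fin 3)) (p : ℝ → EuclideanSpace ℝ (Fin 3) → ℝ) (G : ℝ → EuclideanSpace ℝ (Fin 3) → EuclideanSpace ℝ (Fin 3) →L[ℝ] EuclideanSpace ℝ (Fin 3)) (C : ℝ), Literature.Analysis.FluidPDE.IsSuitableWeakSolutionOn (Literature.Analysis.FluidPDE.slab (EuclideanSpace ℝ (Fin 3)) (Set.Iio 0) isOpen_Iio) 1 0 u p → Literature.Analysis.FluidPDE.HasWeakSpatialGradientOn (Literature.Analysis.FluidPDE.slab (EuclideanSpace ℝ (Fin 3)) (Set.Iio 0) isOpen_Iio) u G → Literature.Analysis.FluidPDE.typeIBound (Set.Iio (0 : ℝ) ×ˢ Set.univ) u p G < ⊤ → Literature.Analysis.FluidPDE.HasTypeIDecay C u → Literature.Analysis.FluidPDE.IsBackwardSingularPoint u 0 → (∀ lam : ℝ, 0 < lam → ∃ (q : ℝ → EuclideanSpace ℝ (Fin 3) → ℝ) (H : ℝ → EuclideanSpace ℝ (Fin 3) → EuclideanSpace ℝ (Fin 3)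 →L[ℝ] EuclideanSpace ℝ (Fin 3)), Literature.Analysis.FluidPDE.IsSuitableWeakSolutionOn (Literature.Analysis.FluidPDE.slab (EuclideanSpace ℝ (Fin 3)) (Set.Iio 0) isOpen_Iio) 1 0 (Literature.Analysis.FluidPDE.nsRescale lam u) q ∧ Literature.Analysis.FluidPDE.HasWeakSpatialGradientOn (Literature.Analysis.FluidPDE.slab (EuclideanSpace ℝ (Fin 3)) (Set.Iio 0) isOpen_Iio) (Literature.Analysis.FluidPDE.nsRescale lam u) H ∧ Literature.Analysis.FluidPDE.typeIBound (Set.Iio (0 : ℝ) ×ˢ Set.univ) (Literature.Analysis.FluidPDE.nsRescale lam u) q H < ⊤ ∧ Literature.Analysis.FluidPDE.HasTypeIDecay C (Literature.Analysis.FluidPDE.nsRescale lam u) ∧ Literature.Analysis.FluidPDE.IsBackwardSingularPoint (Literature.Analysis.FluidPDE.nsRescale lam u) 0) ∧ (∀ θ : ℝ, ∃ (q : ℝ → EuclideanSpace ℝ (Fin 3) → ℝ) (H : ℝ → EuclideanSpace ℝ (Fin 3) → EuclideanSpace ℝ (Fin 3) →L[ℝ] EuclideanSpace ℝ (Fin 3)),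 Literature.Analysis.FluidPDE.IsSuitableWeakSolutionOn (Literature.Analysis.FluidPDE.slab (EuclideanSpace ℝ (Fin 3)) (Set.Iio 0) isOpen_Iio) 1 0 (fun t x => Literature.Analysis.FluidPDE.rotZ θ (u t (Literature.Analysis.FluidPDE.rotZ (-θ) x))) q ∧ Literature.Analysis.FluidPDE.HasWeakSpatialGradientOn (Literature.Analysis.FluidPDE.slab (EuclideanSpace ℝ (Fin 3)) (Set.Iio 0) isOpen_Iio) (fun t x => Literature.Analysis.FluidPDE.rotZ θ (u t (Literature.Analysis.FluidPDE.rotZ (-θ) x))) H ∧ Literature.Analysis.FluidPDE.typeIBound (Set.Iio (0 : ℝ) ×ˢ Set.univ) (fun t x => Literature.Analysis.FluidPDE.rotZ θ (u t (Literature.Analysis.FluidPDE.rotZ (-θ) x))) q H < ⊤ ∧ Literature.Analysis.FluidPDE.HasTypeIDecay C (fun t x => Literature.Analysis.FluidPDE.rotZ θ (u t (Literature.Analysis.FluidPDE.rotZ (-θ) x))) ∧ Literature.Analysis.FluidPDE.IsBackwardSingularPoint (fun t x => Literature.Analysis.FluidPDE.rotZ θ (u t (Literature.Analysis.FluidPDE.rotZ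 (-θ) x))) 0)

-- `SimilarityCovariance` holds: proved by `Summit.NavierStokesRegularity.NavierStokesRegularity.Theorems.RellichScarSimilarityCovariance.similarityCovariance_proof` (its module imports this route file, so no `_holds` link can be stated here).

/-- item stmt-NavierStokesRegularity-11721 · support · rank 9 · closed · proved by Summit.NavierStokesRegularity.NavierStokesRegularity.Theorems.rellichScar_selfSimilarApexFatal_proof @ cbf57c235ebf (prover) · by planner
sources: Tsai1998, NecasRuzickaSverak1996, Literature.Analysis.FluidPDE.tsai_selfsimilar_local_energy_holds
[support] an apex profile singular at the origin cannot be a.e. self-similar (u = λu(λ²·,λ·) a.e.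
for every λ>0): bounded for t ≤ −δ hence smooth on the open slab, it is then exactly self-similar, u
= lerayBackward (1/2) 0 U with a C^∞ Leray profile (U,P), and the local energy bounds A, E ≤ 𝐈 < ∞
on Q((0,0),1) feed Tsai1998 Thm 2 (tree: `tsai_selfsimilar_local_energy_holds`, PROVED) ⇒ U = 0 ⇒ u
= 0, not singular. Known; the work is representative/regularity bookkeeping. [difficulty: M] -/
@[route_item "route-NavierStokesRegularity-RellichScar"]
def SelfSimilarApexFatal : Prop :=
  ∀ (u : ℝ → EuclideanSpace ℝ (Fin 3) → EuclideanSpace ℝ (Fin 3)) (p : ℝ → EuclideanSpace ℝ (Fin 3) → ℝ) (G : ℝ → EuclideanSpace ℝ (Fin 3) → EuclideanSpace ℝ (Fin 3) →L[ℝ] EuclideanSpace ℝ (Fin 3)) (C : ℝ), Literature.Analysis.FluidPDE.IsSuitableWeakSolutionOn (Literature.Analysis.FluidPDE.slab (EuclideanSpace ℝ (Fin 3)) (Set.Iio 0) isOpen_Iio) 1 0 u p → Literature.Analysis.FluidPDE.HasWeakSpatialGradientOn (Literature.Analysis.FluidPDE.slab (EuclideanSpace ℝ (Fin 3)) (Set.Iio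 0) isOpen_Iio) u G → Literature.Analysis.FluidPDE.typeIBound (Set.Iio (0 : ℝ) ×ˢ Set.univ) u p G < ⊤ → Literature.Analysis.FluidPDE.HasTypeIDecay C u → Literature.Analysis.FluidPDE.IsBackwardSingularPoint u 0 → (∀ lam : ℝ, 0 < lam → Function.uncurry (Literature.Analysis.FluidPDE.nsRescale lam u) =ᵐ[MeasureTheory.volume.restrict (Set.Iio (0 : ℝ) ×ˢ Set.univ)] Function.uncurry u) → False

-- `SelfSimilarApexFatal` holds: proved by `Summit.NavierStokesRegularity.NavierStokesRegularity.Theorems.rellichScar_selfSimilarApexFatal_proof` @ cbf57c235ebf (its module imports this route file, so no `_holds` link can be stated here).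

/-- item stmt-NavierStokesRegularity-11722 · support · rank 9 · closed · proved by Summit.NavierStokesRegularity.NavierStokesRegularity.Theorems.rellichScar_axisymmetricApexFatal_proof (prover) · by planner
sources: SereginSverak2009, KNSS2009, Literature.Barriers.NavierStokesRegularity.AxisymmetricTypeIExclusion
[support] an apex profile singular at the origin cannot be a.e. axisymmetric (R_θ u(t,R_θ⁻¹·) = u
a.e. for every θ): averaging over θ gives an exactly axisymmetric representative, a distributional
solution on the unit cylinder with u ∈ L³, p ∈ L^{3/2} and √(−t)|u| ≤ C a.e., so SereginSverak2009
Thm 3.1 (tree: `Literature.Barriers.NavierStokesRegularity.AxisymmetricTypeIExclusion_holds`,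
PROVED) makes the origin regular — contradiction. Known; bookkeeping (Haar averaging lemma,
restriction of the suitable class to the cylinder). [difficulty: M] -/
@[route_item "route-NavierStokesRegularity-RellichScar"]
def AxisymmetricApexFatal : Prop :=
  ∀ (u : ℝ → EuclideanSpace ℝ (Fin 3) → EuclideanSpace ℝ (Fin 3)) (p : ℝ → EuclideanSpace ℝ (Fin 3) → ℝ) (G : ℝ → EuclideanSpace ℝ (Fin 3) → EuclideanSpace ℝ (Fin 3) →L[ℝ] EuclideanSpace ℝ (Fin 3)) (C : ℝ), Literature.Analysis.FluidPDE.IsSuitableWeakSolutionOn (Literature.Analysis.FluidPDE.slab (EuclideanSpace ℝ (Fin 3)) (Set.Iio 0) isOpen_Iio) 1 0 u p → Literature.Analysis.FluidPDE.HasWeakSpatialGradientOn (Literature.Analysis.FluidPDE.slab (EuclideanSpace ℝ (Fin 3)) (Set.Iio 0) isOpen_Iio) u G → Literature.Analysis.FluidPDE.typeIBound (Set.Iio (0 : ℝ) ×ˢ Set.univ) u p G < ⊤ → Literature.Analysis.FluidPDE.HasTypeIDecay C u → Literature.Analysis.FluidPDE.IsBackwardSingularPoint u 0 → (∀ θ :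 ℝ, Function.uncurry (fun t x => Literature.Analysis.FluidPDE.rotZ θ (u t (Literature.Analysis.FluidPDE.rotZ (-θ) x))) =ᵐ[MeasureTheory.volume.restrict (Set.Iio (0 : ℝ) ×ˢ Set.univ)] Function.uncurry u) → False

-- `AxisymmetricApexFatal` holds: proved by `Summit.NavierStokesRegularity.NavierStokesRegularity.Theorems.rellichScar_axisymmetricApexFatal_proof` (its module imports this route file, so no `_holds` link can be stated here).

/-- item stmt-NavierStokesRegularity-11723 · support · rank 9 · closed · proved by Summit.NavierStokesRegularity.NavierStokesRegularity.Theorems.RellichScarNoMildScar.rellichScar_noMildScar_proof @ 9f4e60b5a35f (prover) · by planner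
sources: EscauriazaSereginSverak2003, AlbrittonBarker2019, arXiv:1811.00502, Seregin2012, LemarieRieusset2016
[support] NO MILD SCAR UNDER TYPE I (card P1, unconditional output; not used by `closes`): the scar
of an apex profile singular at the origin is not in L³ near the origin — no σ ∈ L³(B_r) satisfies
ess sup_{(−δ,0)×K} |u − σ| → 0 (δ↓0) for all compact K ∌ 0. Proof sketch (checked informally): if σ
∈ L³(B_r) were the scar, zooms u_λ (λ→0) have scars λσ(λ·) → 0 in L³_loc; a limit ū
(SuitableCompactness_holds, uniform Hölder bounds off 0 from |u_λ| ≤ C/|x|) is an apex profile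
singular at 0 (PersistenceOfSingularities_holds) with ZERO scar; ESS exterior backward uniqueness
for ω̄ on (ℝ³∖B_R)×(−1,0) (tree `ess_backward_uniqueness_holds`) + parabolic unique continuation ⇒
ω̄ ≡ 0 ⇒ ū(t) harmonic, decaying ⇒ ū ≡ 0, contradicting the singularity. The auditor's 'land P1
first'. [difficulty: L] -/
@[route_item "route-NavierStokesRegularity-RellichScar"]
def NoMildScar : Prop :=
  ∀ (u : ℝ → EuclideanSpace ℝ (Fin 3) → EuclideanSpace ℝ (Fin 3)) (p : ℝ → EuclideanSpace ℝ (Fin 3) → ℝ) (G : ℝ → EuclideanSpace ℝ (Fin 3) → EuclideanSpace ℝ (Fin 3) →L[ℝ] EuclideanSpace ℝ (Fin 3)) (C : ℝ), Literature.Analysis.FluidPDE.IsSuitableWeakSolutionOn (Literature.Analysis.FluidPDE.slab (EuclideanSpace ℝ (Fin 3)) (Set.Iio 0) isOpen_Iio) 1 0 u p → Literature.Analysis.FluidPDE.HasWeakSpatialGradientOn (Literature.Analysis.FluidPDE.slab (EuclideanSpace ℝ (Fin 3)) (Set.Iio 0) isOpen_Iio) u G → Literature.Analysis.FluidPDE.typeIBound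 (Set.Iio (0 : ℝ) ×ˢ Set.univ) u p G < ⊤ → Literature.Analysis.FluidPDE.HasTypeIDecay C u → Literature.Analysis.FluidPDE.IsBackwardSingularPoint u 0 → ∀ (σ : EuclideanSpace ℝ (Fin 3) → EuclideanSpace ℝ (Fin 3)) (r : ℝ), 0 < r → MeasureTheory.MemLp σ 3 (MeasureTheory.volume.restrict (Metric.ball (0 : EuclideanSpace ℝ (Fin 3)) r)) → ¬ (∀ K : Set (EuclideanSpace ℝ (Fin 3)), IsCompact K → (0 : EuclideanSpace ℝ (Fin 3)) ∉ K → Filter.Tendsto (fun δ : ℝ => MeasureTheory.eLpNorm (fun z : ℝ × EuclideanSpace ℝ (Fin 3) => u z.1 z.2 - σ z.2) ⊤ (MeasureTheory.volume.restrict (Set.Ioo (-δ) 0 ×ˢ K))) (nhdsWithin 0 (Set.Ioi 0)) (nhds 0))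

-- `NoMildScar` holds: proved by `Summit.NavierStokesRegularity.NavierStokesRegularity.Theorems.RellichScarNoMildScar.rellichScar_noMildScar_proof` @ 9f4e60b5a35f (its module imports this route file, so no `_holds` link can be stated here).

/-- item stmt-NavierStokesRegularity-1591 · support · rank 9 · closed · proved by Summit.NavierStokesRegularity.NavierStokesRegularity.Theorems.typeIBlowupProfile_proof (prover) · by planner
sources: AlbrittonBarker2019, KNSS2009, SereginSverak2009, RusinSverak2011, Lin1998
[support] TYPE-I-RATE BLOW-UP GENERATES A PROFILE SINGULAR AT THE ORIGIN (glue into the A–B class;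
known mathematics, not yet one tree statement). Given ν>0 and a maximal classical solution (u,p) on
[0,T) (IsMaximalSmoothSolution), Leray–Hopf from a rapidly decaying datum, with IsTypeIBlowup u T:
(1) normalise ν=1 by scaling (cf. LocalLerayViscosityScaling); (2) T maximal ⇒ some z=(T,x₀) is a
BACKWARD SINGULAR POINT: L^∞-continuation of classical/Kato solutions + far-field boundedness from
finite energy via CKN ε-regularity + compactness of the closed ball — the in-tree pattern
exists_singularPoint_katoMaximalTime / exists_pos_eLpNorm_lt_top_of_forall_exists_cylinder with the
facts IsKatoSolutionOn.continuation_of_bounded, IsKatoSolutionOn.farField_bound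
(RusinSverakSingularPoint.lean); (3) the rate is L^{2,∞}_t L^∞_x near T, so AlbrittonBarker2019
Lemma 2.5 (weak Serrin ⇒ Type I, via the Morrey estimates of Lemma 2.6 / Seregin 2006–07) gives
𝐈(Q(z,1/2)) < ∞ for the suitable pair (u, p) (A–B Remark 3.2: the forward direction holds for the
L^∞ rate although the rate alone does not bound the scaled energies); (4) zoom in AT z: v_k(y,s) =
λ_k u(x₀+λ_k y, T+λ_k² s), λ_k→0, has 𝐈(v_k; Q -/
@[route_item "route-NavierStokesRegularity-RellichScar"]
def TypeIBlowupProfile : Prop :=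
  ∀ (ν T : ℝ), 0 < ν → 0 < T → ∀ (u : ℝ → EuclideanSpace ℝ (Fin 3) → EuclideanSpace ℝ (Fin 3)) (p : ℝ → EuclideanSpace ℝ (Fin 3) → ℝ), Literature.Analysis.FluidPDE.IsMaximalSmoothSolution ν 0 u p T → Literature.Analysis.FluidPDE.IsLerayHopfOn T ν 0 (u 0) u → Literature.Analysis.FluidPDE.HasRapidSpatialDecay (u 0) → Literature.Analysis.FluidPDE.IsTypeIBlowup u T → ∃ (w : ℝ → EuclideanSpace ℝ (Fin 3) → EuclideanSpace ℝ (Fin 3)) (q : ℝ → EuclideanSpace ℝ (Fin 3) → ℝ) (H : ℝ → EuclideanSpace ℝ (Fin 3) → EuclideanSpace ℝ (Fin 3) →L[ℝ] EuclideanSpace ℝ (Fin 3)) (C : ℝ), Literature.Analysis.FluidPDE.IsSuitableWeakSolutionOn (Literature.Analysis.FluidPDE.slab (EuclideanSpace ℝ (Fin 3)) (Set.Iio 0) isOpen_Iio) 1 0 w q ∧ Literature.Analysis.FluidPDE.HasWeakSpatialGradientOn (Literature.Analysis.FluidPDE.slab (EuclideanSpace ℝ (Fin 3)) (Set.Iio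 0) isOpen_Iio) w H ∧ Literature.Analysis.FluidPDE.typeIBound (Set.Iio (0 : ℝ) ×ˢ Set.univ) w q H < ⊤ ∧ Literature.Analysis.FluidPDE.HasTypeITimeDecay C w ∧ Literature.Analysis.FluidPDE.IsBackwardSingularPoint w 0

-- `TypeIBlowupProfile` holds: proved by `Summit.NavierStokesRegularity.NavierStokesRegularity.Theorems.typeIBlowupProfile_proof` (its module imports this route file, so no `_holds` link can be stated here).

/-- item stmt-NavierStokesRegularity-11724 · assembly · rank 1 · closed · proved by Summit.NavierStokesRegularity.NavierStokesRegularity.Theorems.rellichScar_assembly_proof @ caaac604164f (prover) · by planner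
sources: KNSS2009, AlbrittonBarker2019
[assembly] NoApexTypeIProfile → ApexLocalisation → TypeIBlowupProfile → NoTypeII → ClayFromNoBlowup
→ NavierStokesRegularity (hypotheses inlined verbatim; proved in Sketch.lean as `assembly_holds`,
closable at once). -/
@[route_item "route-NavierStokesRegularity-RellichScar"]
def Assembly : Prop :=
  (∀ (u : ℝ → EuclideanSpace ℝ (Fin 3) → EuclideanSpace ℝ (Fin 3)) (p : ℝ → EuclideanSpace ℝ (Fin 3) → ℝ) (G : ℝ → EuclideanSpace ℝ (Fin 3) → EuclideanSpace ℝ (Fin 3) →L[ℝ] EuclideanSpace ℝ (Fin 3)) (C : ℝ), Literature.Analysis.FluidPDE.IsSuitableWeakSolutionOn (Literature.Analysis.FluidPDE.slab (EuclideanSpace ℝ (Fin 3)) (Set.Iio 0) isOpen_Iio) 1 0 u p → Literature.Analysis.FluidPDE.HasWeakSpatialGradientOn (Literature.Analysis.FluidPDE.slab (EuclideanSpace ℝ (Fin 3)) (Set.Iio 0) isOpen_Iio) u G → Literature.Analysis.FluidPDE.typeIBound (Set.Iio (0 : ℝ) ×ˢ Set.univ) u p G < ⊤ → Literature.Analysis.FluidPDE.HasTypeIDecay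 C u → ¬ Literature.Analysis.FluidPDE.IsBackwardSingularPoint u 0) → (∀ C : ℝ, (∃ (u : ℝ → EuclideanSpace ℝ (Fin 3) → EuclideanSpace ℝ (Fin 3)) (p : ℝ → EuclideanSpace ℝ (Fin 3) → ℝ) (G : ℝ → EuclideanSpace ℝ (Fin 3) → EuclideanSpace ℝ (Fin 3) →L[ℝ] EuclideanSpace ℝ (Fin 3)), Literature.Analysis.FluidPDE.IsSuitableWeakSolutionOn (Literature.Analysis.FluidPDE.slab (EuclideanSpace ℝ (Fin 3)) (Set.Iio 0) isOpen_Iio) 1 0 u p ∧ Literature.Analysis.FluidPDE.HasWeakSpatialGradientOn (Literature.Analysis.FluidPDE.slab (EuclideanSpace ℝ (Fin 3)) (Set.Iio 0) isOpen_Iio) u G ∧ Literature.Analysis.FluidPDE.typeIBound (Set.Iio (0 : ℝ) ×ˢ Set.univ) u p G < ⊤ ∧ Literature.Analysis.FluidPDE.HasTypeITimeDecay C u ∧ Literature.Analysis.FluidPDE.IsBackwardSingularPoint u 0) → ∃ (C' : ℝ) (u : ℝ → EuclideanSpace ℝ (Fin 3) → EuclideanSpace ℝ (Fin 3)) (p :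 ℝ → EuclideanSpace ℝ (Fin 3) → ℝ) (G : ℝ → EuclideanSpace ℝ (Fin 3) → EuclideanSpace ℝ (Fin 3) →L[ℝ] EuclideanSpace ℝ (Fin 3)), Literature.Analysis.FluidPDE.IsSuitableWeakSolutionOn (Literature.Analysis.FluidPDE.slab (EuclideanSpace ℝ (Fin 3)) (Set.Iio 0) isOpen_Iio) 1 0 u p ∧ Literature.Analysis.FluidPDE.HasWeakSpatialGradientOn (Literature.Analysis.FluidPDE.slab (EuclideanSpace ℝ (Fin 3)) (Set.Iio 0) isOpen_Iio) u G ∧ Literature.Analysis.FluidPDE.typeIBound (Set.Iio (0 : ℝ) ×ˢ Set.univ) u p G < ⊤ ∧ Literature.Analysis.FluidPDE.HasTypeIDecay C' u ∧ Literature.Analysis.FluidPDE.IsBackwardSingularPoint u 0) → (∀ (ν T : ℝ), 0 < ν → 0 < T → ∀ (u : ℝ → EuclideanSpace ℝ (Fin 3) → EuclideanSpace ℝ (Fin 3)) (p : ℝ → EuclideanSpace ℝ (Fin 3) → ℝ), Literature.Analysis.FluidPDE.IsMaximalSmoothSolution ν 0 u p T → Literature.Analysis.FluidPDE.IsLerayHopfOn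 T ν 0 (u 0) u → Literature.Analysis.FluidPDE.HasRapidSpatialDecay (u 0) → Literature.Analysis.FluidPDE.IsTypeIBlowup u T → ∃ (w : ℝ → EuclideanSpace ℝ (Fin 3) → EuclideanSpace ℝ (Fin 3)) (q : ℝ → EuclideanSpace ℝ (Fin 3) → ℝ) (H : ℝ → EuclideanSpace ℝ (Fin 3) → EuclideanSpace ℝ (Fin 3) →L[ℝ] EuclideanSpace ℝ (Fin 3)) (C : ℝ), Literature.Analysis.FluidPDE.IsSuitableWeakSolutionOn (Literature.Analysis.FluidPDE.slab (EuclideanSpace ℝ (Fin 3)) (Set.Iio 0) isOpen_Iio) 1 0 w q ∧ Literature.Analysis.FluidPDE.HasWeakSpatialGradientOn (Literature.Analysis.FluidPDE.slab (EuclideanSpace ℝ (Fin 3)) (Set.Iio 0) isOpen_Iio) w H ∧ Literature.Analysis.FluidPDE.typeIBound (Set.Iio (0 : ℝ) ×ˢ Set.univ) w q H < ⊤ ∧ Literature.Analysis.FluidPDE.HasTypeITimeDecay C w ∧ Literature.Analysis.FluidPDE.IsBackwardSingularPoint w 0) → (∀ (ν T : ℝ), 0 < ν → 0 < T → ∀ (u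 : ℝ → EuclideanSpace ℝ (Fin 3) → EuclideanSpace ℝ (Fin 3)) (p : ℝ → EuclideanSpace ℝ (Fin 3) → ℝ), Literature.Analysis.FluidPDE.IsMaximalSmoothSolution ν 0 u p T → Literature.Analysis.FluidPDE.IsLerayHopfOn T ν 0 (u 0) u → Literature.Analysis.FluidPDE.HasRapidSpatialDecay (u 0) → Literature.Analysis.FluidPDE.IsTypeIBlowup u T) → ((∀ (ν T : ℝ), 0 < ν → 0 < T → ∀ (u : ℝ → EuclideanSpace ℝ (Fin 3) → EuclideanSpace ℝ (Fin 3)) (p : ℝ → EuclideanSpace ℝ (Fin 3) → ℝ), Literature.Analysis.FluidPDE.IsClassicalNSSolutionOn (Set.Ico 0 T) ν 0 u p → Literature.Analysis.FluidPDE.IsLerayHopfOn T ν 0 (u 0) u → Literature.Analysis.FluidPDE.HasRapidSpatialDecay (u 0) → Literature.Analysis.FluidPDE.HasSmoothExtensionPast ν 0 u T) → NavierStokesRegularity) → NavierStokesRegularity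

-- `Assembly` holds: proved by `Summit.NavierStokesRegularity.NavierStokesRegularity.Theorems.rellichScar_assembly_proof` @ caaac604164f (its module imports this route file, so no `_holds` link can be stated here).

/-! D-0027 §2.1 — DECIDING THEOREM (planner-authored via `route open/edit --closes-file`; by planner-plancard-NavierStokesRegularity-Navie-4478d59f-0 2026-08-15T18:38:04Z):
its hypotheses are this route's items and its conclusion the sub-problem Statement (glue_lint), and it elaborates with this file. -/

@[closes "route-NavierStokesRegularity-RellichScar"] theorem closes (hSR : ScarRigidity) (hZ : SymmetricScarExists) (hLoc : ApexLocalisation) (hII : NoTypeII)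
    (hCov : SimilarityCovariance) (hSS : SelfSimilarApexFatal) (hAx : AxisymmetricApexFatal)
    (hP : TypeIBlowupProfile) (hClay : ClayFromNoBlowup) : _root_.NavierStokesRegularity := by
  apply hClay
  intro ν T hν hT u p hcl hLH hdec
  by_contra hext
  -- a classical Leray–Hopf solution with no smooth extension past T is maximal; NoTypeII gives the Type-I rate
  have hI : Literature.Analysis.FluidPDE.IsTypeIBlowup u T := hII ν T hν hT u p ⟨hcl, hext⟩ hLH hdec
  -- Type-I-rate blow-up ⇒ a local-energy profile with the Type-I RATE, singular at the origin (shared item)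
  obtain ⟨w, q, H, C, hsw, hgr, hIb, hdecay, hsing⟩ := hP ν T hν hT u p ⟨hcl, hext⟩ hLH hdec hI
  -- localisation ⇒ a profile with the SPACE–TIME Type-I bound at the apex, singular at the origin
  obtain ⟨C', v, q', H', hsw', hgr', hIb', hdec', hsing'⟩ := hLoc C ⟨w, q, H, hsw, hgr, hIb, hdecay, hsing⟩
  -- the closing crux: some such profile has a (−1)-homogeneous or an axisymmetric scar
  obtain ⟨C'', z, pz, Gz, hsz, hgz, hIz, hdz, hsingz, hsym⟩ := hZ C' ⟨v, q', H', hsw', hgr', hIb', hdec', hsing'⟩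
  rcases hsym with hhom | hax
  · -- homogeneous scar: by scar rigidity z is self-similar, which Tsai's theorem forbids
    refine hSS z pz Gz C'' hsz hgz hIz hdz hsingz ?_
    intro lam hlam
    obtain ⟨q₁, H₁, hs₁, hg₁, hI₁, hd₁, hsing₁⟩ := (hCov z pz Gz C'' hsz hgz hIz hdz hsingz).1 lam hlam
    exact hSR _ q₁ H₁ z pz Gz C'' hs₁ hg₁ hI₁ hd₁ hsz hgz hIz hdz hsing₁ hsingz (hhom lam hlam)
  · -- axisymmetric scar: by scar rigidity z is axisymmetric, which Seregin–Šverák's theorem forbids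
    refine hAx z pz Gz C'' hsz hgz hIz hdz hsingz ?_
    intro θ
    obtain ⟨q₁, H₁, hs₁, hg₁, hI₁, hd₁, hsing₁⟩ := (hCov z pz Gz C'' hsz hgz hIz hdz hsingz).2 θ
    exact hSR _ q₁ H₁ z pz Gz C'' hs₁ hg₁ hI₁ hd₁ hsz hgz hIz hdz hsing₁ hsingz (hax θ)

end Summit.NavierStokesRegularity.NavierStokesRegularity.Theses.RellichScar
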